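import Literature.NumberTheory.GaloisRepresentations.ArtinConductor
import Literature.NumberTheory.GaloisRepresentations.RamificationFiltrationProofs
import HarnessLib

/-!
# The «max 2» comparison principle for Artin conductors of two rank-`2` representations with the same wild behaviour
# (brick LM-C of `stub_levelMatch_ns`)

Route `SignedLowerHalves`, child L `SmallImageLowerHalfBothSigns` (item stmt-BirchSwinnertonDyer-23599), line `rtt_w3`
(v2 proposal `Lines/rtt_w3_v2.lean`, stub `stub_levelMatch_ns`: `max 2 (v_ℓ M) = max 2 (v_ℓ N_W)` at `ℓ ≠ p` for every
congruent CM partner; width seat `bsd-line-slh-p3-w3` gen 10; memo `Lines/birth_acns-MEMO-w3-g10.md` §4).  THEOREMS ONLY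
(no definition, no named fact, no `sorry`); ROUTE-INDEPENDENT.

Two Galois representations `ρ₁, ρ₂` of `Γ_K` on `2`-dimensional spaces (over possibly different coefficient fields), a
prime `𝔓` of `\bar ℤ_K` with its absolute upper ramification groups `Γ^u = absUpperRamificationSubgroup R 𝔓 u`:

* `GaloisRep.swanConductorAt_eq_of_codimFixed_eq` — equal integrands `codim M^{Γ^u}` (`u > 0`) ⟹ equal Swan conductors;
  `GaloisRep.exists_codimFixed_ne_zero_of_swanConductorAt_ne_zero` — a non-zero Swan conductor is seen by some `Γ^u`,
  `u > 0`; `GaloisRep.swanConductorAt_nonneg`.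
* **`GaloisRep.max_two_floor_artinConductorAt_eq`** — if for every `u > 0` each of `ρ₁, ρ₂` has `Γ^u`-fixed space `⊥`
  or `⊤` (DICHOTOMY, brick LM-B for inertia with trivial determinant and exponent prime to the characteristic) and `Γ^u`
  acts trivially on `ρ₁` iff on `ρ₂` (REDUCTION, brick LM-A: both iff it acts trivially on the common residual
  representation), then `max 2 ⌊a_𝔓(ρ₁)⌋ = max 2 ⌊a_𝔓(ρ₂)⌋`: either both Swan conductors vanish and both exponents are the
  tame codimensions `≤ 2`, or some `Γ^u` kills both fixed spaces, hence the inertia-fixed spaces, and both exponents are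
  `2 + sw`.  `GaloisRep.max_two_artinConductorExponent_eq` — the same for `artinConductorExponent v` (number field `K`).

BSD, crux L and the stub are NOT proved here.

References: J.-P. Serre, Corps locaux IV §3, VI §2; N. Katz, Gauss sums… (1988) 1.6–1.9; folklore.
-/

set_option autoImplicit false
set_option linter.dupNamespace false

noncomputable section

open scoped NumberField
open Module MeasureTheory IsDedekindDomain Field NumberField

namespace Summit.BirchSwinnertonDyer.BirchSwinnertonDyer.Theorems.SmallImageLambdaLowerThreeNsThetaPartner

open Literature.NumberTheory.GaloisRepresentations

universe u

section General

variable {K : Type u} [Field K] {A₁ : Type*} [Field A₁] [TopologicalSpace A₁] {A₂ : Type*} [Field A₂]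
  [TopologicalSpace A₂] {M₁ : Type*} [AddCommGroup M₁] [Module A₁ M₁] [TopologicalSpace M₁]
  {M₂ : Type*} [AddCommGroup M₂] [Module A₂ M₂] [TopologicalSpace M₂]
  (R : Type*) [CommRing R] [Algebra R K]

/-- Equal codimensions of the `Γ^u`-fixed spaces for all `u > 0` give equal Swan conductors. [folklore] -/
theorem GaloisRep.swanConductorAt_eq_of_codimFixed_eq (𝔓 : Ideal (absIntegers R K)) (ρ₁ : GaloisRep K A₁ M₁)
    (ρ₂ : GaloisRep K A₂ M₂)
    (h : ∀ u : ℝ, 0 < u →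
      ρ₁.codimFixed (absUpperRamificationSubgroup R 𝔓 u) = ρ₂.codimFixed (absUpperRamificationSubgroup R 𝔓 u)) :
    ρ₁.swanConductorAt R 𝔓 = ρ₂.swanConductorAt R 𝔓 := by
  unfold GaloisRep.swanConductorAt
  exact setIntegral_congr_fun measurableSet_Ioi fun u hu => by rw [h u hu]

/-- A non-zero Swan conductor is detected by some ramification group `Γ^u`, `u > 0`, acting non-trivially. [folklore] -/
theorem GaloisRep.exists_codimFixed_ne_zero_of_swanConductorAt_ne_zero (𝔓 : Ideal (absIntegers R K))
    (ρ : GaloisRep K A₁ M₁) (h : ρ.swanConductorAt R 𝔓 ≠ 0) :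
    ∃ u : ℝ, 0 < u ∧ ρ.codimFixed (absUpperRamificationSubgroup R 𝔓 u) ≠ 0 := by
  by_contra hcon
  push Not at hcon
  apply h
  unfold GaloisRep.swanConductorAt
  exact setIntegral_eq_zero_of_forall_eq_zero fun u hu => by rw [hcon u hu, Nat.cast_zero]

/-- The Swan conductor is non-negative. [folklore] -/
theorem GaloisRep.swanConductorAt_nonneg (𝔓 : Ideal (absIntegers R K)) (ρ : GaloisRep K A₁ M₁) :
    0 ≤ ρ.swanConductorAt R 𝔓 := by
  unfold GaloisRep.swanConductorAt
  exact setIntegral_nonneg measurableSet_Ioi fun u _ => Nat.cast_nonneg _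

end General

section Codim

variable {G : Type*} [Group G] [TopologicalSpace G] {A : Type*} [Field A] [TopologicalSpace A]
  {M : Type*} [AddCommGroup M] [Module A M] [TopologicalSpace M] [FiniteDimensional A M]

/-- The codimension of a fixed space is at most the dimension. [folklore] -/
theorem codimFixed_le_finrank (ρ : ContinuousRep G A M) (H : Subgroup G) : ρ.codimFixed H ≤ finrank A M := by
  rw [ContinuousRep.codimFixed_eq_finrank_sub]
  exact Nat.sub_le _ _

/-- `codim M^H = dim M` iff `M^H = ⊥`. [folklore] -/
theorem codimFixed_eq_finrank_iff (ρ : ContinuousRep G A M) (H : Subgroup G) :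
    ρ.codimFixed H = finrank A M ↔ ρ.fixedSubmodule H = ⊥ := by
  rw [ContinuousRep.codimFixed, ← Submodule.finrank_eq_zero, ← (ρ.fixedSubmodule H).finrank_quotient_add_finrank]
  constructor
  · intro h; omega
  · intro h; omega

end Codim

section MaxTwo

variable {K : Type u} [Field K] {A₁ : Type*} [Field A₁] [TopologicalSpace A₁] {A₂ : Type*} [Field A₂]
  [TopologicalSpace A₂] {M₁ : Type*} [AddCommGroup M₁] [Module A₁ M₁] [TopologicalSpace M₁] [FiniteDimensional A₁ M₁]
  {M₂ : Type*} [AddCommGroup M₂] [Module A₂ M₂] [TopologicalSpace M₂] [FiniteDimensional A₂ M₂]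
  (R : Type*) [CommRing R] [Algebra R K]

/-- **The «max 2» comparison principle.**  Let `ρ₁, ρ₂` act on `2`-dimensional spaces.  Suppose that for every `u > 0`
each `Γ^u`-fixed space is `⊥` or `⊤` (dichotomy) and that `Γ^u` acts trivially on `ρ₁` iff on `ρ₂`, and that the `Γ^u`
lie in the inertia group `I_𝔓`.  Then `max 2 ⌊a_𝔓(ρ₁)⌋ = max 2 ⌊a_𝔓(ρ₂)⌋`. [folklore] -/
theorem GaloisRep.max_two_floor_artinConductorAt_eq (𝔓 : Ideal (absIntegers R K)) (ρ₁ : GaloisRep K A₁ M₁)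
    (ρ₂ : GaloisRep K A₂ M₂) (h₁ : finrank A₁ M₁ = 2) (h₂ : finrank A₂ M₂ = 2)
    (hle : ∀ u : ℝ, 0 < u → absUpperRamificationSubgroup R 𝔓 u ≤ 𝔓.inertia (absoluteGaloisGroup K))
    (hd₁ : ∀ u : ℝ, 0 < u → ρ₁.fixedSubmodule (absUpperRamificationSubgroup R 𝔓 u) = ⊥ ∨
      ρ₁.fixedSubmodule (absUpperRamificationSubgroup R 𝔓 u) = ⊤)
    (hd₂ : ∀ u : ℝ, 0 < u → ρ₂.fixedSubmodule (absUpperRamificationSubgroup R 𝔓 u) = ⊥ ∨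
      ρ₂.fixedSubmodule (absUpperRamificationSubgroup R 𝔓 u) = ⊤)
    (htriv : ∀ u : ℝ, 0 < u → (ρ₁.fixedSubmodule (absUpperRamificationSubgroup R 𝔓 u) = ⊤ ↔
      ρ₂.fixedSubmodule (absUpperRamificationSubgroup R 𝔓 u) = ⊤)) :
    max 2 ⌊ρ₁.artinConductorAt R 𝔓⌋₊ = max 2 ⌊ρ₂.artinConductorAt R 𝔓⌋₊ := by
  -- equal integrands, hence equal Swan conductors
  have hcodim : ∀ u : ℝ, 0 < u →
      ρ₁.codimFixed (absUpperRamificationSubgroup R 𝔓 u) = ρ₂.codimFixed (absUpperRamificationSubgroup R 𝔓 u) := by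
    intro u hu
    rcases hd₁ u hu with hb | ht
    · have hb₂ : ρ₂.fixedSubmodule (absUpperRamificationSubgroup R 𝔓 u) = ⊥ := by
        rcases hd₂ u hu with hb₂ | ht₂
        · exact hb₂
        · have ht₁ := (htriv u hu).mpr ht₂
          rw [ht₁] at hb
          have : finrank A₁ M₁ = 0 := by rw [← finrank_top A₁ M₁, hb, finrank_bot]
          omega
      rw [(codimFixed_eq_finrank_iff ρ₁ _).mpr hb, (codimFixed_eq_finrank_iff ρ₂ _).mpr hb₂, h₁, h₂]
    · have ht₂ := (htriv u hu).mp ht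
      rw [ContinuousRep.codimFixed, ContinuousRep.codimFixed, ht, ht₂]
      haveI : Subsingleton (M₁ ⧸ (⊤ : Submodule A₁ M₁)) := Submodule.Quotient.subsingleton_iff.mpr rfl
      haveI : Subsingleton (M₂ ⧸ (⊤ : Submodule A₂ M₂)) := Submodule.Quotient.subsingleton_iff.mpr rfl
      rw [finrank_zero_of_subsingleton, finrank_zero_of_subsingleton]
  have hsw : ρ₁.swanConductorAt R 𝔓 = ρ₂.swanConductorAt R 𝔓 :=
    GaloisRep.swanConductorAt_eq_of_codimFixed_eq R 𝔓 ρ₁ ρ₂ hcodim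
  have hsw0 := GaloisRep.swanConductorAt_nonneg R 𝔓 ρ₁
  have hc₁ := codimFixed_le_finrank ρ₁ (𝔓.inertia (absoluteGaloisGroup K))
  have hc₂ := codimFixed_le_finrank ρ₂ (𝔓.inertia (absoluteGaloisGroup K))
  rw [h₁] at hc₁
  rw [h₂] at hc₂
  unfold GaloisRep.artinConductorAt
  by_cases hs : ρ₁.swanConductorAt R 𝔓 = 0
  · -- tame: both exponents are `≤ 2`
    have hs₂ : ρ₂.swanConductorAt R 𝔓 = 0 := hsw ▸ hs
    rw [hs, hs₂, add_zero, add_zero, Nat.floor_natCast, Nat.floor_natCast, max_eq_left hc₁, max_eq_left hc₂]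
  · -- wild: some `Γ^u` kills both fixed spaces, hence the inertia-fixed spaces
    obtain ⟨u, hu, hne⟩ := GaloisRep.exists_codimFixed_ne_zero_of_swanConductorAt_ne_zero R 𝔓 ρ₁ hs
    have hb₁ : ρ₁.fixedSubmodule (absUpperRamificationSubgroup R 𝔓 u) = ⊥ := by
      rcases hd₁ u hu with hb | ht
      · exact hb
      · exact absurd (ρ₁.codimFixed_eq_zero_of_forall_eq_one ((ρ₁.fixedSubmodule_eq_top_iff _).mp ht)) hne
    have hb₂ : ρ₂.fixedSubmodule (absUpperRamificationSubgroup R 𝔓 u) = ⊥ := by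
      rcases hd₂ u hu with hb | ht
      · exact hb
      · have ht₁ := (htriv u hu).mpr ht
        rw [ht₁] at hb₁
        have : finrank A₁ M₁ = 0 := by rw [← finrank_top A₁ M₁, hb₁, finrank_bot]
        omega
    have hI₁ : ρ₁.fixedSubmodule (𝔓.inertia (absoluteGaloisGroup K)) = ⊥ :=
      le_bot_iff.mp (hb₁ ▸ ρ₁.fixedSubmodule_antitone (hle u hu))
    have hI₂ : ρ₂.fixedSubmodule (𝔓.inertia (absoluteGaloisGroup K)) = ⊥ :=
      le_bot_iff.mp (hb₂ ▸ ρ₂.fixedSubmodule_antitone (hle u hu))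
    rw [(codimFixed_eq_finrank_iff ρ₁ _).mpr hI₁, (codimFixed_eq_finrank_iff ρ₂ _).mpr hI₂, h₁, h₂, hsw]

end MaxTwo

section NumberField

variable {K : Type} [Field K] [NumberField K] {A₁ : Type*} [Field A₁] [TopologicalSpace A₁] {A₂ : Type*} [Field A₂]
  [TopologicalSpace A₂] {M₁ : Type*} [AddCommGroup M₁] [Module A₁ M₁] [TopologicalSpace M₁] [FiniteDimensional A₁ M₁]
  {M₂ : Type*} [AddCommGroup M₂] [Module A₂ M₂] [TopologicalSpace M₂] [FiniteDimensional A₂ M₂]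

/-- **The «max 2» comparison principle for conductor exponents at a finite place.**  With `𝔓` the prime above `v`
chosen by `GaloisRep.artinConductorExponent` and the hypotheses of `max_two_floor_artinConductorAt_eq` at `𝔓`
(`Γ^u ≤ I_𝔓` being the tree theorem `absUpperRamificationSubgroup_le_inertia_holds`):
`max 2 (a_v(ρ₁)) = max 2 (a_v(ρ₂))`. [folklore] -/
theorem GaloisRep.max_two_artinConductorExponent_eq (v : HeightOneSpectrum (𝓞 K)) (ρ₁ : GaloisRep K A₁ M₁)
    (ρ₂ : GaloisRep K A₂ M₂) (h₁ : finrank A₁ M₁ = 2) (h₂ : finrank A₂ M₂ = 2)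
    (hd₁ : ∀ u : ℝ, 0 < u →
      ρ₁.fixedSubmodule (absUpperRamificationSubgroup (𝓞 K) (HeightOneSpectrum.primesAbove_nonempty v).some u) = ⊥ ∨
      ρ₁.fixedSubmodule (absUpperRamificationSubgroup (𝓞 K) (HeightOneSpectrum.primesAbove_nonempty v).some u) = ⊤)
    (hd₂ : ∀ u : ℝ, 0 < u →
      ρ₂.fixedSubmodule (absUpperRamificationSubgroup (𝓞 K) (HeightOneSpectrum.primesAbove_nonempty v).some u) = ⊥ ∨
      ρ₂.fixedSubmodule (absUpperRamificationSubgroup (𝓞 K) (HeightOneSpectrum.primesAbove_nonempty v).some u) = ⊤)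
    (htriv : ∀ u : ℝ, 0 < u →
      (ρ₁.fixedSubmodule (absUpperRamificationSubgroup (𝓞 K) (HeightOneSpectrum.primesAbove_nonempty v).some u) = ⊤ ↔
        ρ₂.fixedSubmodule (absUpperRamificationSubgroup (𝓞 K) (HeightOneSpectrum.primesAbove_nonempty v).some u) = ⊤)) :
    max 2 (ρ₁.artinConductorExponent v) = max 2 (ρ₂.artinConductorExponent v) :=
  GaloisRep.max_two_floor_artinConductorAt_eq (𝓞 K) _ ρ₁ ρ₂ h₁ h₂
    (fun u _ => absUpperRamificationSubgroup_le_inertia_holds (𝓞 K) _ u) hd₁ hd₂ htriv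

end NumberField

end Summit.BirchSwinnertonDyer.BirchSwinnertonDyer.Theorems.SmallImageLambdaLowerThreeNsThetaPartner

end
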